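import Mathlib
import HarnessLib

/-!
# Sort-merge evaluation of polynomial certificates: a kernel-friendly nonnegativity check for large sparse coefficient lists (lane prim-rate, constants-miner 1, gen 34; NEXT-g35 item 1)

Support file for the closed crux `NoHeavyLowerTail` (stmt-CriticalPhenomena-4575), majority-gluing line; infrastructure for the DEGREE-3 certificates of the cut-pattern
language (`…MajorityGluingQCert*`: one Sherali–Adams lift breaks the `5/4` floor of the degree-2 language at the cell `(6,4)`, kit j269592, but such certificates carry
`10⁴`–`10⁵` multipliers).  A certificate identity `LHS − RHS = R ≥ 0` is checked coefficientwise; when every entry expands into a short list of CONTRIBUTIONS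
`(monomial key, integer coefficient)`, the whole check is: concatenate all contributions (with the `LHS` ones), SORT by key, and verify that every run of equal keys has
a nonnegative sum.  This file provides exactly that, in a form the kernel evaluates by structural recursion only: `mergeK` / `msortK` (merge sort with explicit fuel —
core's `List.mergeSort` is well-founded and does not reduce in the kernel), `runsOK` (the run scan), and the SOUNDNESS theorem `evalC_nonneg_of_runsOK_msortK`: if the scan
accepts the sorted list then `Σ c·val(key) ≥ 0` for every nonnegative valuation `val` of the keys — using only that merge sort is a PERMUTATION (`msortK_perm`) and that run
grouping is re-association (sortedness is needed for the check to succeed, never for soundness).  Cost: `O(N log N)` kernel steps for `N` contributions.  Pure list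
arithmetic; no sorries. [folklore]
-/

namespace Summit.CriticalPhenomena.PercolationContinuityZ3.Theorems

namespace HubOnly
namespace QCert

/-! ### Merge sort by key, with fuel -/

/-- Merge two lists of `(key, coefficient)` pairs by key (fuel-structural; with enough fuel and sorted inputs the output is sorted). -/
def mergeK : ℕ → List (ℕ × ℤ) → List (ℕ × ℤ) → List (ℕ × ℤ)
  | 0, l₁, l₂ => l₁ ++ l₂
  | _ + 1, [], l₂ => l₂
  | _ + 1, a :: l₁, [] => a :: l₁
  | f + 1, a :: l₁, b :: l₂ => if a.1 ≤ b.1 then a :: mergeK f l₁ (b :: l₂) else b :: mergeK f (a :: l₁) l₂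

/-- Alternate split of a list into two halves. -/
def splitAlt {α : Type*} : List α → List α × List α
  | [] => ([], [])
  | [a] => ([a], [])
  | a :: b :: l => (a :: (splitAlt l).1, b :: (splitAlt l).2)

/-- Merge sort by key with fuel (`fuel ≥ log₂ length` suffices for full sorting; any fuel is sound). -/
def msortK : ℕ → List (ℕ × ℤ) → List (ℕ × ℤ)
  | 0, l => l
  | _ + 1, [] => []
  | _ + 1, [a] => [a]
  | f + 1, a :: b :: l =>
    mergeK (l.length + 2) (msortK f (a :: (splitAlt l).1)) (msortK f (b :: (splitAlt l).2))

/-- `mergeK` is a permutation of the concatenation. -/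
theorem mergeK_perm : ∀ (f : ℕ) (l₁ l₂ : List (ℕ × ℤ)), (mergeK f l₁ l₂).Perm (l₁ ++ l₂)
  | 0, l₁, l₂ => by rw [mergeK]
  | f + 1, [], l₂ => by rw [mergeK]; simp
  | f + 1, a :: l₁, [] => by rw [mergeK]; simp
  | f + 1, a :: l₁, b :: l₂ => by
    rw [mergeK]
    split_ifs
    · exact (mergeK_perm f l₁ (b :: l₂)).cons a
    · have h := (mergeK_perm f (a :: l₁) l₂).cons b
      exact h.trans (List.perm_middle.symm)

/-- `splitAlt` is a permutation (as a concatenation of its halves). -/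
theorem splitAlt_perm {α : Type*} : ∀ l : List α, ((splitAlt l).1 ++ (splitAlt l).2).Perm l
  | [] => by simp [splitAlt]
  | [a] => by simp [splitAlt]
  | a :: b :: l => by
    show (a :: ((splitAlt l).1 ++ b :: (splitAlt l).2)).Perm (a :: b :: l)
    exact (List.perm_middle.trans ((splitAlt_perm l).cons b)).cons a

/-- `msortK` is a permutation. -/
theorem msortK_perm : ∀ (f : ℕ) (l : List (ℕ × ℤ)), (msortK f l).Perm l
  | 0, l => by rw [msortK]
  | f + 1, [] => by rw [msortK]
  | f + 1, [a] => by rw [msortK]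
  | f + 1, a :: b :: l => by
    rw [msortK]
    refine (mergeK_perm _ _ _).trans ?_
    refine ((msortK_perm f _).append (msortK_perm f _)).trans ?_
    show (a :: ((splitAlt l).1 ++ b :: (splitAlt l).2)).Perm (a :: b :: l)
    exact (List.perm_middle.trans ((splitAlt_perm l).cons b)).cons a

/-! ### The run scan -/

/-- Scan with the current key `k` and accumulated coefficient `acc`: every completed run must have a nonnegative sum. -/
def runsGo (k : ℕ) (acc : ℤ) : List (ℕ × ℤ) → Bool
  | [] => decide (0 ≤ acc)
  | (k', c') :: l => if k' = k then runsGo k (acc + c') l else decide (0 ≤ acc) && runsGo k' c' l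

/-- **The run check:** adjacent equal keys are grouped and every group sum is nonnegative. -/
def runsOK : List (ℕ × ℤ) → Bool
  | [] => true
  | (k, c) :: l => runsGo k c l

/-! ### Soundness -/

noncomputable section

/-- The value `Σ c·val(key)` of a contribution list at a valuation of the keys. -/
def evalC (val : ℕ → ℝ) (l : List (ℕ × ℤ)) : ℝ := (l.map fun e => (e.2 : ℝ) * val e.1).sum

/-- `evalC` is invariant under permutations. -/
theorem evalC_perm (val : ℕ → ℝ) {l₁ l₂ : List (ℕ × ℤ)} (h : l₁.Perm l₂) : evalC val l₁ = evalC val l₂ := by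
  unfold evalC; exact (h.map _).sum_eq

/-- The scan invariant: if `runsGo k acc l` accepts then `acc·val k + evalC val l ≥ 0` (nonnegative valuation). -/
theorem runsGo_sound (val : ℕ → ℝ) (hval : ∀ i, 0 ≤ val i) :
    ∀ (l : List (ℕ × ℤ)) (k : ℕ) (acc : ℤ), runsGo k acc l = true → 0 ≤ (acc : ℝ) * val k + evalC val l
  | [], k, acc, h => by
    rw [runsGo, decide_eq_true_eq] at h
    simp only [evalC, List.map_nil, List.sum_nil, add_zero]
    exact mul_nonneg (by exact_mod_cast h) (hval k)
  | (k', c') :: l, k, acc, h => by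
    rw [runsGo] at h
    simp only [evalC, List.map_cons, List.sum_cons]
    split_ifs at h with hk
    · have ih := runsGo_sound val hval l k (acc + c') h
      subst hk
      simp only [evalC, Int.cast_add] at ih ⊢
      linarith
    · rw [Bool.and_eq_true, decide_eq_true_eq] at h
      have ih := runsGo_sound val hval l k' c' h.2
      have h0 : 0 ≤ (acc : ℝ) * val k := mul_nonneg (by exact_mod_cast h.1) (hval k)
      simp only [evalC] at ih
      linarith

/-- **Soundness of the run check:** an accepted list has a nonnegative value at every nonnegative valuation. -/
theorem evalC_nonneg_of_runsOK (val : ℕ → ℝ) (hval : ∀ i, 0 ≤ val i) (l : List (ℕ × ℤ)) (h : runsOK l = true) :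
    0 ≤ evalC val l := by
  cases l with
  | nil => simp [evalC]
  | cons e l =>
    obtain ⟨k, c⟩ := e
    rw [runsOK] at h
    have := runsGo_sound val hval l k c h
    simpa [evalC] using this

/-- **SORT-MERGE NONNEGATIVITY:** if the run check accepts the key-sorted contribution list, the value is nonnegative at every nonnegative valuation —
whatever the fuel (only `msortK_perm` is used). -/
theorem evalC_nonneg_of_runsOK_msortK (val : ℕ → ℝ) (hval : ∀ i, 0 ≤ val i) (fuel : ℕ) (l : List (ℕ × ℤ))
    (h : runsOK (msortK fuel l) = true) : 0 ≤ evalC val l := by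
  rw [← evalC_perm val (msortK_perm fuel l)]
  exact evalC_nonneg_of_runsOK val hval _ h

/-- Concatenation adds values. -/
theorem evalC_append (val : ℕ → ℝ) (l₁ l₂ : List (ℕ × ℤ)) : evalC val (l₁ ++ l₂) = evalC val l₁ + evalC val l₂ := by
  simp [evalC, List.map_append, List.sum_append]

/-- A flattened list of contribution lists evaluates to the sum of the values. -/
theorem evalC_flatten (val : ℕ → ℝ) (L : List (List (ℕ × ℤ))) : evalC val L.flatten = (L.map (evalC val)).sum := by
  induction L with
  | nil => simp [evalC]
  | cons l L ih => rw [List.flatten_cons, evalC_append, ih, List.map_cons, List.sum_cons]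

end

/-! ### Smoke test -/

/-- The scan on a small sorted example: keys `1,1,2,5,5,5` with run sums `0, 3, 1`. -/
theorem runsOK_example : runsOK (msortK 4 [(5, 2), (1, -3), (2, 3), (5, -4), (1, 3), (5, 3)]) = true := by decide +kernel

end QCert
end HubOnly

end Summit.CriticalPhenomena.PercolationContinuityZ3.Theorems
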